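import Summits.CriticalPhenomena.PercolationContinuityZ3.Theorems.Transplant.KNCells2ChainS
import HarnessLib

/-!
# The ROOTED band run WITHOUT the idle backward-room constraint: `ChainPlanar.Band.BandOKR` (= p1-g9's `BandOK` minus
# `hρ0 : 3q + s₁ + 2R' ≤ ρ`) and the rooted band schedule `Band.scheduleRO` over it — pure `Site 2` geometry (lane INBOX 2026-08-21 ≈08:05Z,
# p2-g8 → p3-g7: LEVEL-1 interface defect and fix)

builds on p205010 (kernel theorem, internal audit signed; external expert review pending) — nothing in this file uses p205010.
Lane `prim-bschramm`, seat `prim-bschramm-p2` (gen 8); helper file (`--supports stmt-CriticalPhenomena-4575 --as helper`).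

WHY.  p1-g9's admissibility record `BandOK q q' s₁ ρ R' ℓ₀ N WM Wb` (KNCells2ChainBand) bundles `hρ0 : 3q + s₁ + 2R' ≤ ρ`, the BACKWARD room of the
PLAIN start region `region 0 = sBox a σ c (−ρ) (q + s₁) ρ` (there `ρ` serves both as the transverse half-width and as the axial extent below the
start box).  The ROOTED run (`Band.scheduleR`, regions `Adv.regionR`: region `0` reaches only `ρ₀ = 3q + s₁ + 2R'` below the start box, `ρ` is
TRANSVERSE ONLY) takes the same record, although none of its lemmas uses `hρ0` (the rooted start route `route_band_startR` needs only
`q' + R' + WM ≤ ρ`; the advance steps need `w + R' + WM ≤ ρ`).  For the D″ node the stride along an axis is the Step-I′ unit `e∥` while the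
transverse room is measured in the OTHER unit (`ρ ≤ 5r⊥ − 1 = 5A·e⊥ − 1` for (R), `≈ r⊥` for (F), `2r⊥` for (C)), and `TwoUnitL` puts no bound on
`e∥ / e⊥`: for a skew pair `hρ0` is unsatisfiable in every residue's run along the long-unit axis.  This file removes it: `BandOKR` and the five
rooted-run lemmas re-proved from `route_band_startR` / `route_band_advance` (p1-g9's proofs, the `k ≠ 0` branches inlined), and the schedule
`scheduleRO` with the same data fields — hence the same `rfl` API — as `scheduleR`.
* `Band.BandOKR`, `Band.BandOK.toBandOKR`;
* `Band.core_routeRO`, `Band.enlarge_core_subset_regionRO`, `Band.core_succ_subset_regionRO`, `Band.regionR_subset_prismRO`, `Band.core_nonemptyRO`;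
* **`Band.scheduleRO`**, `scheduleRO_core/_region/_ax/_Wb/_params/_core_zero/_core_last`, `scheduleRO_eq_scheduleR` (same schedule as
  `scheduleR` whenever the full `BandOK` holds).
[cite: KozmaNitzan2024, §4 Lemma 11 (pp. 22–23)]
-/

noncomputable section

namespace Summit.CriticalPhenomena.PercolationContinuityZ3.Theorems

namespace Transplant

namespace ChainPlanar

open Literature.Probability.Percolation Literature.Probability.LatticeModels
open Literature.Probability.Percolation.KozmaNitzan
open Literature.Probability.Percolation.KozmaNitzan.Cells (oth oth_ne eq_oth_of_ne)

namespace Band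

/-- **Admissible parameters of a ROOTED band run**: p1-g9's `BandOK` without the backward-room constraint `hρ0 : 3q + s₁ + 2R' ≤ ρ` (idle for
the rooted regions `Adv.regionR`, whose `ρ` is transverse only). [this work] -/
structure BandOKR (q q' s₁ ρ : ℤ) (R' ℓ₀ N WM : ℕ) (Wb : ℕ → ℕ) : Prop where
  hq : 0 ≤ q
  hq' : 0 ≤ q'
  hs : (R' : ℤ) + ℓ₀ ≤ s₁
  hs2 : 2 * (R' : ℤ) ≤ s₁
  hρ : q' + ((N : ℤ) + 1) * R' + 2 * WM ≤ ρ
  hWM : ∀ ℓ : ℕ, (ℓ : ℤ) ≤ 2 * q + s₁ + R' → Wb ℓ ≤ WM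

/-- The full record implies the rooted one. [folklore] -/
theorem BandOK.toBandOKR {q q' s₁ ρ : ℤ} {R' ℓ₀ N WM : ℕ} {Wb : ℕ → ℕ} (h : BandOK q q' s₁ ρ R' ℓ₀ N WM Wb) :
    BandOKR q q' s₁ ρ R' ℓ₀ N WM Wb :=
  ⟨h.hq, h.hq', h.hs, h.hs2, h.hρ, h.hWM⟩

variable {q q' s₁ ρ : ℤ} {R' N WM ℓ₀ : ℕ} {Wb : ℕ → ℕ} {a : Fin 2} {σ : ℤ} (hσ : σ = 1 ∨ σ = -1) (c : Site 2)
  (h : BandOKR q q' s₁ ρ R' ℓ₀ N WM Wb)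
include hσ h

/-- **BAND ROUTES of the rooted band run** (`k ≤ N`), rooted admissibility: as p1-g9's `Band.core_routeR`.
[cite: KozmaNitzan2024, §4 Lemma 11 (pp. 22–23)] -/
theorem core_routeRO {k : ℕ} (hk : k ≤ N) {v : Site 2}
    (hv : v ∈ sBox a σ c (Adv.coreα q s₁ k - R') (Adv.coreβ q s₁ k + R') (coreW q' R' WM k + R')) :
    ∃ ℓ : ℕ, ℓ₀ ≤ ℓ ∧ (ℓ : ℤ) ≤ 2 * q + s₁ + R' ∧ (ℓ : ℤ) = Adv.coreβ q s₁ (k + 1) - σ * (v a - c a) ∧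
      (∀ y : Site 2, |y a - v a| ≤ ℓ → |y (oth a) - v (oth a)| ≤ Wb ℓ → y ∈ regionR q s₁ ρ R' a σ c k) ∧
      ∃ τ : ℤ, (τ = 1 ∨ τ = -1) ∧ ∀ y : Site 2, y a - v a = σ * ℓ → 0 ≤ τ * (y (oth a) - v (oth a)) →
        |y (oth a) - v (oth a)| ≤ Wb ℓ → y ∈ core q q' s₁ R' WM a σ c (k + 1) := by
  obtain ⟨⟨e0α, e0β, e0W⟩, eF⟩ := core_params (q := q) (q' := q') (s₁ := s₁) (R' := R') (WM := WM)
  have hq := h.hq; have hq' := h.hq'; have hs := h.hs; have hs2 := h.hs2; have hρ := h.hρ; have hWM := h.hWM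
  have hR0 : (0 : ℤ) ≤ R' := by positivity
  have hW0 : (0 : ℤ) ≤ WM := by positivity
  have hNR : (0 : ℤ) ≤ (N : ℤ) * R' := by positivity
  by_cases hk0 : k = 0
  · subst hk0
    obtain ⟨e1α, e1β, e1W⟩ := eF 1 le_rfl
    rw [e0α, e0β, e0W] at hv
    obtain ⟨ℓ, hℓ0, hℓhi, hℓ, hrect, τ, hτ, hhalf⟩ := route_band_startR hσ c (q := q) (q' := q') (s := s₁) (ρ := ρ) (R' := R')
      (ℓ₀ := ℓ₀) (WM := WM) Wb hs hWM (by nlinarith) hv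
    refine ⟨ℓ, hℓ0, hℓhi, by rw [e1β]; push_cast; linarith, fun y h1 h2 => ?_, τ, hτ, fun y h1 h2 h3 => ?_⟩
    · rw [regionR, Adv.regionR, if_pos rfl]; exact hrect y h1 h2
    · rw [core, e1α, e1β, e1W, w₁]
      have hy := hhalf y h1 h2 h3
      push_cast
      refine sBox_mono hσ c (by linarith) (by linarith) ?_ hy
      exact max_le (by linarith) (by linarith)
  · have hk1 : 1 ≤ k := by omega
    obtain ⟨eα, eβ, eW⟩ := eF k hk1
    obtain ⟨eα', eβ', eW'⟩ := eF (k + 1) (by omega)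
    have hkR : ((k : ℤ) - 1) * R' ≤ ((N : ℤ) - 1) * R' :=
      mul_le_mul_of_nonneg_right (by linarith [(by exact_mod_cast hk : (k : ℤ) ≤ N)]) hR0
    have hkR0 : 0 ≤ ((k : ℤ) - 1) * R' := mul_nonneg (by linarith [(by exact_mod_cast hk1 : (1 : ℤ) ≤ k)]) hR0
    rw [eα, eβ, eW] at hv
    have hWM' : ∀ ℓ : ℕ, (ℓ : ℤ) ≤ s₁ + R' → Wb ℓ ≤ WM := fun ℓ hℓ => hWM ℓ (by linarith)
    obtain ⟨ℓ, hℓ0, hℓhi, hℓ, hrect, τ, hτ, hhalf⟩ := route_band_advance hσ c (L := q + (k : ℤ) * s₁) (s := s₁)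
      (w := w₁ q' R' WM + ((k : ℤ) - 1) * R') (ρ := ρ) (R' := R') (ℓ₀ := ℓ₀) (WM := WM) Wb hs hs2 hWM' (by unfold w₁; nlinarith) hv
    refine ⟨ℓ, hℓ0, by linarith, by rw [eβ']; push_cast; linarith, fun y h1 h2 => ?_, τ, hτ, fun y h1 h2 h3 => ?_⟩
    · rw [regionR, Adv.regionR_of_ne_zero hk0, Adv.region, if_neg hk0]; exact hrect y h1 h2
    · rw [core, eα', eβ', eW']
      have hy := hhalf y h1 h2 h3
      push_cast
      refine sBox_mono hσ c (by linarith) (by linarith) ?_ hy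
      exact max_le (by linarith) (by unfold w₁; linarith)

/-- **The `R'`-enlargement of core `k ≤ N` lies in the rooted region `k`**, rooted admissibility. [cite: KozmaNitzan2024, §4 Lemma 11 (p. 22)] -/
theorem enlarge_core_subset_regionRO {k : ℕ} (hk : k ≤ N) :
    sBox a σ c (Adv.coreα q s₁ k - R') (Adv.coreβ q s₁ k + R') (coreW q' R' WM k + R') ⊆ regionR q s₁ ρ R' a σ c k := by
  obtain ⟨⟨e0α, e0β, e0W⟩, eF⟩ := core_params (q := q) (q' := q') (s₁ := s₁) (R' := R') (WM := WM)
  have hq := h.hq; have hq' := h.hq'; have hs := h.hs; have hs2 := h.hs2; have hρ := h.hρ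
  have hR0 : (0 : ℤ) ≤ R' := by positivity
  have hW0 : (0 : ℤ) ≤ WM := by positivity
  have hNR : (0 : ℤ) ≤ (N : ℤ) * R' := by positivity
  by_cases hk0 : k = 0
  · subst hk0
    rw [e0α, e0β, e0W, regionR, Adv.regionR, if_pos rfl, Adv.ρ₀]
    exact sBox_mono hσ c (by linarith) (by linarith) (by linarith)
  · have hk1 : 1 ≤ k := by omega
    obtain ⟨eα, eβ, eW⟩ := eF k hk1
    have hkR : ((k : ℤ) - 1) * R' ≤ ((N : ℤ) - 1) * R' :=
      mul_le_mul_of_nonneg_right (by linarith [(by exact_mod_cast hk : (k : ℤ) ≤ N)]) hR0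
    rw [eα, eβ, eW, regionR, Adv.regionR_of_ne_zero hk0, Adv.region, if_neg hk0]
    exact sBox_mono hσ c (by linarith) (by linarith) (by unfold w₁; nlinarith)

/-- **The next core lies in the rooted region `k`** (`k ≤ N`), rooted admissibility. [cite: KozmaNitzan2024, §4 Lemma 11 (p. 22)] -/
theorem core_succ_subset_regionRO {k : ℕ} (hk : k ≤ N) : core q q' s₁ R' WM a σ c (k + 1) ⊆ regionR q s₁ ρ R' a σ c k := by
  obtain ⟨-, eF⟩ := core_params (q := q) (q' := q') (s₁ := s₁) (R' := R') (WM := WM)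
  have hq := h.hq; have hq' := h.hq'; have hs := h.hs; have hs2 := h.hs2; have hρ := h.hρ
  have hR0 : (0 : ℤ) ≤ R' := by positivity
  have hW0 : (0 : ℤ) ≤ WM := by positivity
  have hNR : (0 : ℤ) ≤ (N : ℤ) * R' := by positivity
  obtain ⟨eα, eβ, eW⟩ := eF (k + 1) (by omega)
  have hkR : (((k + 1 : ℕ) : ℤ) - 1) * R' ≤ (N : ℤ) * R' :=
    mul_le_mul_of_nonneg_right (by push_cast; linarith [(by exact_mod_cast hk : (k : ℤ) ≤ N)]) hR0
  have hkR0 : 0 ≤ (((k + 1 : ℕ) : ℤ) - 1) * R' := mul_nonneg (by push_cast; linarith [(Nat.cast_nonneg k : (0 : ℤ) ≤ k)]) hR0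
  rw [core, eα, eβ, eW]
  by_cases hk0 : k = 0
  · subst hk0
    rw [regionR, Adv.regionR, if_pos rfl, Adv.ρ₀]
    push_cast
    exact sBox_mono hσ c (by linarith) (by linarith) (by unfold w₁; linarith)
  · rw [regionR, Adv.regionR_of_ne_zero hk0, Adv.region, if_neg hk0]
    push_cast
    exact sBox_mono hσ c (by nlinarith) (by linarith) (by unfold w₁; nlinarith)

/-- **All rooted regions lie in the prism** `{-(3q + s₁ + 2R') ≤ level ≤ q + (N+1) s₁, |trans| ≤ ρ}`, rooted admissibility.
[cite: KozmaNitzan2024, §4 Lemma 11 (p. 22: Ω)] -/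
theorem regionR_subset_prismRO {k : ℕ} (hk : k ≤ N) :
    regionR q s₁ ρ R' a σ c k ⊆ sBox a σ c (-(Adv.ρ₀ q s₁ R')) (q + ((N : ℤ) + 1) * s₁) ρ := by
  have hq := h.hq; have hs := h.hs; have hs2 := h.hs2
  have hR0 : (0 : ℤ) ≤ R' := by positivity
  have hs0 : 0 ≤ s₁ := by linarith
  have hNs : (0 : ℤ) ≤ (N : ℤ) * s₁ := by positivity
  rw [regionR]
  by_cases hk0 : k = 0
  · subst hk0; rw [Adv.regionR, if_pos rfl]
    exact sBox_mono hσ c le_rfl (by nlinarith) le_rfl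
  · have hk1 : 1 ≤ k := by omega
    rw [Adv.regionR, if_neg hk0, Adv.ρ₀]
    have hks : (k : ℤ) * s₁ ≤ (N : ℤ) * s₁ := mul_le_mul_of_nonneg_right (by exact_mod_cast hk) hs0
    have hks1 : s₁ ≤ (k : ℤ) * s₁ := by
      have : (1 : ℤ) * s₁ ≤ (k : ℤ) * s₁ := mul_le_mul_of_nonneg_right (by exact_mod_cast hk1) hs0
      linarith
    exact sBox_mono hσ c (by linarith) (by linarith) le_rfl

/-- **All cores are nonempty**, rooted admissibility. [folklore] -/
theorem core_nonemptyRO (k : ℕ) : (core q q' s₁ R' WM a σ c k).Nonempty := by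
  obtain ⟨⟨e0α, e0β, e0W⟩, eF⟩ := core_params (q := q) (q' := q') (s₁ := s₁) (R' := R') (WM := WM)
  have hq := h.hq; have hq' := h.hq'
  have hR0 : (0 : ℤ) ≤ R' := by positivity
  have hW0 : (0 : ℤ) ≤ WM := by positivity
  rw [core]
  by_cases hk0 : k = 0
  · subst hk0; rw [e0α, e0β, e0W]; exact sBox_nonempty hσ c (by linarith) hq'
  · obtain ⟨eα, eβ, eW⟩ := eF k (by omega)
    have hkR0 : 0 ≤ ((k : ℤ) - 1) * R' := mul_nonneg (by linarith [(by exact_mod_cast (by omega : 1 ≤ k) : (1 : ℤ) ≤ k)]) hR0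
    rw [eα, eβ, eW]; exact sBox_nonempty hσ c le_rfl (by unfold w₁; linarith)

omit h in
/-- **The rooted band run as a planar schedule, rooted admissibility** (same data as `Band.scheduleR`: cores `Band.core`, regions
`Band.regionR`, constant axis `a` and sign `σ`, extents `≤ ℓ₁` for any `ℓ₁ ≥ 2q + s₁ + R'`). [cite: KozmaNitzan2024, §4 Lemma 11 (pp. 22–23)] -/
def scheduleRO (a : Fin 2) (h : BandOKR q q' s₁ ρ R' ℓ₀ N WM Wb) {ℓ₁ : ℕ} (hℓ₁ : 2 * q + s₁ + R' ≤ ℓ₁) : Schedule where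
  ax := fun _ => a
  lo := fun k => sLo a σ c (Adv.coreα q s₁ k) (Adv.coreβ q s₁ k) (coreW q' R' WM k)
  hi := fun k => sHi a σ c (Adv.coreα q s₁ k) (Adv.coreβ q s₁ k) (coreW q' R' WM k)
  region := regionR q s₁ ρ R' a σ c
  prism := sBox a σ c (-(Adv.ρ₀ q s₁ R')) (q + ((N : ℤ) + 1) * s₁) ρ
  N := N
  R' := R'
  ℓ₀ := ℓ₀
  ℓ₁ := ℓ₁
  Wb := fun _ => Wb
  encl k hk := by
    rw [sBox_enlarge a σ hσ]
    exact enlarge_core_subset_regionRO hσ c h hk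
  succ k hk := core_succ_subset_regionRO hσ c h hk
  sub_prism k hk := regionR_subset_prismRO hσ c h hk
  nonempty k _ := core_nonemptyRO hσ c h k
  route k hk v hv := by
    rw [sBox_enlarge a σ hσ] at hv
    obtain ⟨ℓ, h0, h1, -, hrect, τ, hτ, hhalf⟩ := core_routeRO hσ c h hk hv
    have h1' : ℓ ≤ ℓ₁ := by
      have : (ℓ : ℤ) ≤ ℓ₁ := h1.trans hℓ₁
      exact_mod_cast this
    exact ⟨ℓ, h0, h1', σ, hσ, hrect, τ, hτ, hhalf⟩

omit h

variable (a : Fin 2) (h : BandOKR q q' s₁ ρ R' ℓ₀ N WM Wb) {ℓ₁ : ℕ} (hℓ₁ : 2 * q + s₁ + R' ≤ ℓ₁)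

/-- The cores of the rooted band schedule are the band cores. [folklore] -/
@[simp] theorem scheduleRO_core (k : ℕ) : (scheduleRO hσ c a h hℓ₁).core k = core q q' s₁ R' WM a σ c k := rfl

/-- The regions of the rooted band schedule. [folklore] -/
@[simp] theorem scheduleRO_region : (scheduleRO hσ c a h hℓ₁).region = regionR q s₁ ρ R' a σ c := rfl

/-- The axis of the rooted band schedule. [folklore] -/
@[simp] theorem scheduleRO_ax (k : ℕ) : (scheduleRO hσ c a h hℓ₁).ax k = a := rfl

/-- The band spread of the rooted band schedule. [folklore] -/
@[simp] theorem scheduleRO_Wb (k : ℕ) : (scheduleRO hσ c a h hℓ₁).Wb k = Wb := rfl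

/-- The parameters of the rooted band schedule. [folklore] -/
theorem scheduleRO_params : (scheduleRO hσ c a h hℓ₁).N = N ∧ (scheduleRO hσ c a h hℓ₁).R' = R' ∧ (scheduleRO hσ c a h hℓ₁).ℓ₀ = ℓ₀ ∧
    (scheduleRO hσ c a h hℓ₁).ℓ₁ = ℓ₁ ∧ (scheduleRO hσ c a h hℓ₁).prism = sBox a σ c (-(Adv.ρ₀ q s₁ R')) (q + ((N : ℤ) + 1) * s₁) ρ :=
  ⟨rfl, rfl, rfl, rfl, rfl⟩

/-- **The first core of the rooted band schedule is the start box** `{|level| ≤ q, |trans| ≤ q'}`. [folklore] -/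
theorem scheduleRO_core_zero : (scheduleRO hσ c a h hℓ₁).core 0 = sBox a σ c (-q) q q' := by
  rw [scheduleRO_core]
  exact (core_zero_last (q := q) (q' := q') (s₁ := s₁) (R' := R') (N := N) (WM := WM) (a := a) (σ := σ) (c := c)).1

/-- **The last core of the rooted band schedule is the far line core.** [folklore] -/
theorem scheduleRO_core_last : (scheduleRO hσ c a h hℓ₁).core (N + 1) =
    sBox a σ c (q + ((N : ℤ) + 1) * s₁) (q + ((N : ℤ) + 1) * s₁) (w₁ q' R' WM + (N : ℤ) * R') := by
  rw [scheduleRO_core]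
  exact (core_zero_last (q := q) (q' := q') (s₁ := s₁) (R' := R') (N := N) (WM := WM) (a := a) (σ := σ) (c := c)).2

omit h in
/-- Under the full `BandOK` the two rooted schedules coincide (same data). [folklore] -/
theorem scheduleRO_eq_scheduleR (h : BandOK q q' s₁ ρ R' ℓ₀ N WM Wb) :
    scheduleRO hσ c a h.toBandOKR hℓ₁ = scheduleR a hσ c h hℓ₁ := rfl

end Band

end ChainPlanar

end Transplant

end Summit.CriticalPhenomena.PercolationContinuityZ3.Theorems

end
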